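import Literature.NumberTheory.LFunctions.WeilTwoPrimeOddMarginKBase
import Literature.NumberTheory.LFunctions.WeilBlockRows
import HarnessLib

/-!
# Two-prime odd-margin certificate K: rows 0–17 of the check `D C = I` (odd block)

Part of the odd-block check of `weilCert23K` (`WeilCert.checkDCRow`), `decide +kernel` row by row. Pure proof file; nothing is asserted.
-/

noncomputable section

namespace Literature.NumberTheory.LFunctions

set_option maxHeartbeats 0 in
/-- Kernel check of row 0 of `D C = I` (certificate K). [folklore] -/
theorem checkDCRow1_0_weilCert23K : weilCert23KBase.checkDCRow 1 0 = true := by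
  decide +kernel

set_option maxHeartbeats 0 in
/-- Kernel check of row 1 of `D C = I` (certificate K). [folklore] -/
theorem checkDCRow1_1_weilCert23K : weilCert23KBase.checkDCRow 1 1 = true := by
  decide +kernel

set_option maxHeartbeats 0 in
/-- Kernel check of row 2 of `D C = I` (certificate K). [folklore] -/
theorem checkDCRow1_2_weilCert23K : weilCert23KBase.checkDCRow 1 2 = true := by
  decide +kernel

set_option maxHeartbeats 0 in
/-- Kernel check of row 3 of `D C = I` (certificate K). [folklore] -/
theorem checkDCRow1_3_weilCert23K : weilCert23KBase.checkDCRow 1 3 = true := by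
  decide +kernel

set_option maxHeartbeats 0 in
/-- Kernel check of row 4 of `D C = I` (certificate K). [folklore] -/
theorem checkDCRow1_4_weilCert23K : weilCert23KBase.checkDCRow 1 4 = true := by
  decide +kernel

set_option maxHeartbeats 0 in
/-- Kernel check of row 5 of `D C = I` (certificate K). [folklore] -/
theorem checkDCRow1_5_weilCert23K : weilCert23KBase.checkDCRow 1 5 = true := by
  decide +kernel

set_option maxHeartbeats 0 in
/-- Kernel check of row 6 of `D C = I` (certificate K). [folklore] -/
theorem checkDCRow1_6_weilCert23K : weilCert23KBase.checkDCRow 1 6 = true := by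
  decide +kernel

set_option maxHeartbeats 0 in
/-- Kernel check of row 7 of `D C = I` (certificate K). [folklore] -/
theorem checkDCRow1_7_weilCert23K : weilCert23KBase.checkDCRow 1 7 = true := by
  decide +kernel

set_option maxHeartbeats 0 in
/-- Kernel check of row 8 of `D C = I` (certificate K). [folklore] -/
theorem checkDCRow1_8_weilCert23K : weilCert23KBase.checkDCRow 1 8 = true := by
  decide +kernel

set_option maxHeartbeats 0 in
/-- Kernel check of row 9 of `D C = I` (certificate K). [folklore] -/
theorem checkDCRow1_9_weilCert23K : weilCert23KBase.checkDCRow 1 9 = true := by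
  decide +kernel

set_option maxHeartbeats 0 in
/-- Kernel check of row 10 of `D C = I` (certificate K). [folklore] -/
theorem checkDCRow1_10_weilCert23K : weilCert23KBase.checkDCRow 1 10 = true := by
  decide +kernel

set_option maxHeartbeats 0 in
/-- Kernel check of row 11 of `D C = I` (certificate K). [folklore] -/
theorem checkDCRow1_11_weilCert23K : weilCert23KBase.checkDCRow 1 11 = true := by
  decide +kernel

set_option maxHeartbeats 0 in
/-- Kernel check of row 12 of `D C = I` (certificate K). [folklore] -/
theorem checkDCRow1_12_weilCert23K : weilCert23KBase.checkDCRow 1 12 = true := by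
  decide +kernel

set_option maxHeartbeats 0 in
/-- Kernel check of row 13 of `D C = I` (certificate K). [folklore] -/
theorem checkDCRow1_13_weilCert23K : weilCert23KBase.checkDCRow 1 13 = true := by
  decide +kernel

set_option maxHeartbeats 0 in
/-- Kernel check of row 14 of `D C = I` (certificate K). [folklore] -/
theorem checkDCRow1_14_weilCert23K : weilCert23KBase.checkDCRow 1 14 = true := by
  decide +kernel

set_option maxHeartbeats 0 in
/-- Kernel check of row 15 of `D C = I` (certificate K). [folklore] -/
theorem checkDCRow1_15_weilCert23K : weilCert23KBase.checkDCRow 1 15 = true := by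
  decide +kernel

set_option maxHeartbeats 0 in
/-- Kernel check of row 16 of `D C = I` (certificate K). [folklore] -/
theorem checkDCRow1_16_weilCert23K : weilCert23KBase.checkDCRow 1 16 = true := by
  decide +kernel

set_option maxHeartbeats 0 in
/-- Kernel check of row 17 of `D C = I` (certificate K). [folklore] -/
theorem checkDCRow1_17_weilCert23K : weilCert23KBase.checkDCRow 1 17 = true := by
  decide +kernel


end Literature.NumberTheory.LFunctions
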